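import Summits.BirchSwinnertonDyer.BirchSwinnertonDyer.Theorems.EisensteinDepletionAtTwoStarOptBNSFX1Gamma1Pres
import Summits.BirchSwinnertonDyer.BirchSwinnertonDyer.Theorems.EisensteinDepletionAtTwoStarOptBNSFX1RatPres
import Literature.NumberTheory.EllipticCurves.PeriodLatticeGamma1QuotientProofs
import Literature.NumberTheory.EllipticCurves.RealLatticeCovolumeProofs
import Literature.NumberTheory.EllipticCurves.ModularCurve
import Literature.NumberTheory.EllipticCurves.ModularSymbolsLattice
import Literature.NumberTheory.Automorphic.ModularLambdaQExpansion
import HarnessLib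

/-!
# The rational `Γ₁(N)`-denominator of `x ∘ φ₁` (line `nsf` v21, stub S3-X `stub_x1Denominator`, crux `StarOptBNSF`, stmt-BirchSwinnertonDyer-27047)

**Stub S3-X CLOSED.**  For `W₁/ℚ` with newform `f ∈ S₂(Γ₀(N))`, Néron pair `L₁ ⊇ c₁Λ₁(f)` (`c₁ ∈ ℚˣ`), there are `k ≥ 1`
and cusp forms `G₁, Φ₁ ∈ S_k(Γ₁(N))`, `G₁ ≠ 0` with RATIONAL `q`-expansion, and `Φ₁ = x_{W₁}·G₁` off the poles of
`x_{W₁}(τ) = ℘_{L₁}(c₁u_f(τ)) − b₂/12`.  Assembly of the two previous files: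
* `Λ′ := (c₁φ(N))⁻¹L₁ ⊇ Λ₀(f)` (tree `totient_mul_mem_periodLatticeGamma1`: `φ(N)Λ₀(f) ⊆ Λ₁(f)`), with rational `g₂, g₃`
  (homogeneity `g₂_mulLeft` + `IsNeronLatticeOf`), so `x′ = ℘_{Λ′}(u)` has a POINTWISE RATIONAL `Γ₀(N)`-presentation `(F, G)`,
  `D·aₘ(G) ∈ ℤ` (`…X1RatPres.exists_rat_isXPresentation`);
* `Λ″ := c₁⁻¹L₁`, `Λ₁(f) ⊆ Λ″ ⊆ Λ′`, `x_{W₁} = c₁⁻²℘_{Λ″}(u) − b₂/12` (homogeneity `weierstrassP_mulLeft`); the `Γ₁(N)`-presentation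
  `Φ = ℘_{Λ″}(u)·G₁`, `G₁ = G·f^a` (`…X1Gamma1Pres.exists_gamma1_presentation`); `Φ₁ := c₁⁻²Φ − (b₂/12)G₁`;
* `q-exp(G₁) = q-exp(G)·q-exp(f)^a` (Mathlib `qExpansion_mul`, tree `qExpansion_pow`) is rational since `aₙ(f) = aₙ(W₁) ∈ ℤ`.
Nothing here reads `r_an`; BSD is not proved by this file.
-/

set_option linter.dupNamespace false
set_option autoImplicit false

noncomputable section

open Complex Filter Topology Set Function
open UpperHalfPlane hiding I
open scoped Real Topology Manifold MatrixGroups PeriodPair ModularForm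
open ModularForm CongruenceSubgroup

open Literature.NumberTheory.EllipticCurves Literature.NumberTheory.EllipticCurves.ModularForms
open Summit.BirchSwinnertonDyer.BirchSwinnertonDyer.Theorems.DepletionAtTwo

namespace Summit.BirchSwinnertonDyer.BirchSwinnertonDyer.Theorems.DepletionAtTwo.X1Denominator

/-- The product `G·f^a` of nonzero cusp forms is not the zero function (analytic factors on the connected half-plane).
[folklore] -/
theorem mul_pow_ne_zero {N : ℕ} {k : ℤ} (G : CuspForm (Gamma0 N) k) (f : CuspForm (Gamma0 N) 2) (a : ℕ)
    (hG : G ≠ 0) (hf : f ≠ 0) : (fun τ : ℍ ↦ G τ * f τ ^ a) ≠ 0 := by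
  intro h0
  set H : Set ℂ := {z : ℂ | 0 < z.im} with hH
  have hGan : AnalyticOnNhd ℂ ((⇑G) ∘ ofComplex) H :=
    (UpperHalfPlane.mdifferentiable_iff.mp G.holo').analyticOnNhd isOpen_upperHalfPlaneSet
  have hfan : AnalyticOnNhd ℂ (fun z ↦ ((⇑f) ∘ ofComplex) z ^ a) H := fun z hz ↦
    ((UpperHalfPlane.mdifferentiable_iff.mp f.holo').analyticOnNhd isOpen_upperHalfPlaneSet z hz).pow a
  rcases AnalyticOnNhd.eq_zero_or_eq_zero_of_mul_eq_zero hGan hfan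
    (fun z _ ↦ by simpa using congrFun h0 (ofComplex z)) convex_setOf_im_pos.isPreconnected with h | h
  · exact hG (DFunLike.ext _ _ fun τ ↦ by simpa [ofComplex_apply] using h τ τ.im_pos)
  · apply hf
    refine DFunLike.ext _ _ fun τ ↦ ?_
    have h1 : f τ ^ a = 0 := by simpa [ofComplex_apply] using h τ τ.im_pos
    rcases Nat.eq_zero_or_pos a with ha | ha
    · simp [ha] at h1
    · simpa using (pow_eq_zero_iff ha.ne').mp h1

/-- **Stub S3-X `stub_x1Denominator` of line `nsf` v21 (crux `StarOptBNSF`, stmt-BirchSwinnertonDyer-27047), registered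
signature verbatim.**  A RATIONAL `Γ₁(N)`-DENOMINATOR FOR `x ∘ φ₁`: for `W₁` with newform `f`, Néron pair `L₁ ⊇ c₁Λ₁(f)`,
there are cusp forms `G₁, Φ₁ ∈ S_k(Γ₁(N))`, `k ≥ 1`, `G₁ ≠ 0`, `G₁` with RATIONAL `q`-expansion at `∞`, and `Φ₁ = x_{W₁}·G₁`
off the poles of `x_{W₁}(τ) = ℘_{L₁}(c₁u_f(τ)) − b₂/12` (see the file docstring for the construction).
[cite: ShimuraIATAF1971, §2.4, Thm. 3.52 and Thm. 7.14] [cite: CremonaAlgorithms1997, §2.10] -/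
theorem stub_x1Denominator :
    ∀ (W₁ : WeierstrassCurve ℚ) [W₁.IsElliptic] [W₁.IsGloballyMinimal]
      ⦃N : ℕ⦄ [NeZero N] (f : CuspForm (CongruenceSubgroup.Gamma0 N) 2), IsNewformOf W₁ f →
      ∀ (L₁ : PeriodPair), IsNeronLatticeOf (W₁.baseChange ℂ) L₁ →
      ∀ (c₁ : ℚ), c₁ ≠ 0 → (∀ z ∈ periodLatticeGamma1 f, (c₁ : ℂ) * z ∈ L₁.lattice) →
      ∃ (k : ℤ) (G₁ Φ₁ : CuspForm (CongruenceSubgroup.Gamma1 N) k), 1 ≤ k ∧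
        (G₁ : UpperHalfPlane → ℂ) ≠ 0 ∧
        (∀ n : ℕ, ∃ r : ℚ, PowerSeries.coeff n (UpperHalfPlane.qExpansion (1 : ℝ) G₁) = (r : ℂ)) ∧
        ∀ τ : UpperHalfPlane, (c₁ : ℂ) * eichlerIntegral f τ ∉ L₁.lattice →
          Φ₁ τ = (L₁.weierstrassP ((c₁ : ℂ) * eichlerIntegral f τ) - ((W₁.b₂ : ℚ) : ℂ) / 12) * G₁ τ := by
  intro W₁ _ _ N _ f hW₁ L₁ hL₁ c₁ hc₁ hin
  have hf : f ≠ 0 := hW₁.1.ne_zero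
  have hc : (c₁ : ℂ) ≠ 0 := by exact_mod_cast hc₁
  -- rationality of the coefficients of `f`
  have hrat : ∀ n, ∃ q : ℚ, (q : ℂ) = cuspCoeff f n := fun n ↦
    ⟨(W₁.LFunction n : ℚ), by rw [hW₁.2 n]; push_cast; rfl⟩
  -- the lattices `Λ′ = (c₁φ(N))⁻¹L₁ ⊇ Λ₀(f)` and `Λ″ = c₁⁻¹L₁ ⊇ Λ₁(f)`
  have hφ : (Nat.totient N : ℂ) ≠ 0 := by exact_mod_cast (Nat.totient_pos.mpr (NeZero.pos N)).ne'
  have hcφ : ((c₁ : ℂ) * (Nat.totient N : ℂ))⁻¹ ≠ 0 := inv_ne_zero (mul_ne_zero hc hφ)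
  set L' : PeriodPair := L₁.mulLeft (((c₁ : ℂ) * (Nat.totient N : ℂ))⁻¹) hcφ with hL'
  have hmem' : ∀ v : ℂ, v ∈ L'.lattice ↔ (c₁ : ℂ) * (Nat.totient N : ℂ) * v ∈ L₁.lattice := by
    intro v; rw [hL', PeriodPair.mem_mulLeft_lattice, inv_inv]
  have hci : ((c₁ : ℂ)⁻¹) ≠ 0 := inv_ne_zero hc
  set L'' : PeriodPair := L₁.mulLeft ((c₁ : ℂ)⁻¹) hci with hL''
  have hmem'' : ∀ v : ℂ, v ∈ L''.lattice ↔ (c₁ : ℂ) * v ∈ L₁.lattice := by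
    intro v; rw [hL'', PeriodPair.mem_mulLeft_lattice, inv_inv]
  have hΛ₀ : ∀ x ∈ periodLattice f, x ∈ L'.lattice := by
    intro x hx
    rw [hmem', mul_assoc]
    exact hin _ (totient_mul_mem_periodLatticeGamma1 f hx)
  have hΛ₁ : ∀ x ∈ periodLatticeGamma1 f, x ∈ L''.lattice := fun x hx ↦ (hmem'' x).mpr (hin x hx)
  have hsub : ∀ v ∈ L''.lattice, v ∈ L'.lattice := by
    intro v hv
    rw [hmem''] at hv
    rw [hmem', mul_comm (c₁ : ℂ), mul_assoc]
    have := PeriodPair.intCast_mul_mem hv (Nat.totient N : ℤ)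
    simpa using this
  -- `g₂(Λ′), g₃(Λ′) ∈ ℚ`
  have hg₂ : ∃ q : ℚ, (q : ℂ) = L'.g₂ := by
    refine ⟨(c₁ * Nat.totient N) ^ 4 * (W₁.c₄ / 12), ?_⟩
    rw [hL', PeriodPair.g₂_mulLeft, hL₁.1, inv_pow, inv_inv]
    simp only [WeierstrassCurve.baseChange, WeierstrassCurve.map_c₄, eq_ratCast]
    push_cast
    ring
  have hg₃ : ∃ q : ℚ, (q : ℂ) = L'.g₃ := by
    refine ⟨(c₁ * Nat.totient N) ^ 6 * (W₁.c₆ / 216), ?_⟩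
    rw [hL', PeriodPair.g₃_mulLeft, hL₁.2, inv_pow, inv_inv]
    simp only [WeierstrassCurve.baseChange, WeierstrassCurve.map_c₆, eq_ratCast]
    push_cast
    ring
  -- the rational `Γ₀(N)`-presentation of `x′` and its `Γ₁(N)`-transfer to `x″`
  obtain ⟨k₁, F, G, D, hk₁, hpres, hD, hDint⟩ :=
    X1RatPres.exists_rat_isXPresentation f hf hrat L' hΛ₀ hg₂ hg₃
  obtain ⟨a, G₁, Φ, _, hG₁, hΦ⟩ := X1Gamma1Pres.exists_gamma1_presentation f hf L'' L' hΛ₁ hsub hpres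
  -- homogeneity: `℘_{L₁}(c₁w) = c₁⁻²℘_{Λ″}(w)`
  have hscale : ∀ w : ℂ, L₁.weierstrassP ((c₁ : ℂ) * w) = ((c₁ : ℂ) ^ 2)⁻¹ * ℘[L''] w := by
    intro w
    have h := PeriodPair.weierstrassP_mulLeft ((c₁ : ℂ)⁻¹) hci L₁ ((c₁ : ℂ) * w)
    rw [inv_mul_cancel_left₀ hc, inv_pow, inv_inv] at h
    rw [h, ← mul_assoc, inv_mul_cancel₀ (pow_ne_zero 2 hc), one_mul]
  refine ⟨k₁ + 2 * (a : ℤ), G₁, ((c₁ : ℂ) ^ 2)⁻¹ • Φ - (((W₁.b₂ : ℚ) : ℂ) / 12) • G₁, by omega, ?_, ?_, ?_⟩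
  · -- `G₁ ≠ 0`
    have hcoe : (⇑G₁ : ℍ → ℂ) = fun τ : ℍ ↦ G τ * f τ ^ a := funext hG₁
    rw [hcoe]
    exact mul_pow_ne_zero G f a hpres.1 hf
  · -- rational `q`-expansion: `q-exp(G₁) = q-exp(G)·q-exp(f)^a`
    intro n
    have hcoe : (⇑G₁ : ℍ → ℂ) = ⇑G * (⇑f) ^ a := by funext τ; simp [hG₁ τ]
    have hGa : AnalyticAt ℂ (cuspFunction 1 (⇑G)) 0 :=
      ModularFormClass.analyticAt_cuspFunction_zero G one_pos (one_mem_strictPeriods_coe_gamma0 N)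
    have hfa : AnalyticAt ℂ (cuspFunction 1 (⇑f)) 0 :=
      ModularFormClass.analyticAt_cuspFunction_zero f one_pos (one_mem_strictPeriods_coe_gamma0 N)
    obtain ⟨hpow, hcf⟩ := Literature.NumberTheory.Automorphic.ModularLambda.qExpansion_pow hfa a
    have hfa' : AnalyticAt ℂ (cuspFunction 1 ((⇑f) ^ a)) 0 := by rw [hcf]; exact hfa.pow a
    have hq : qExpansion 1 (⇑G₁) = qExpansion 1 (⇑G) * qExpansion 1 (⇑f) ^ a := by
      rw [hcoe, UpperHalfPlane.qExpansion_mul hGa hfa', hpow]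
    choose zG hzG using hDint
    have hD' : (D : ℂ) ≠ 0 := by exact_mod_cast hD.ne'
    set P : PowerSeries ℚ := PowerSeries.mk fun m ↦ (zG m : ℚ) / D with hP
    set Q : PowerSeries ℚ := PowerSeries.mk fun m ↦ (W₁.LFunction m : ℚ) with hQ
    have hPG : P.map (algebraMap ℚ ℂ) = qExpansion 1 (⇑G) := by
      ext m
      rw [PowerSeries.coeff_map, hP, PowerSeries.coeff_mk, qExpansion_eq_mk_cuspCoeff, PowerSeries.coeff_mk,
        eq_ratCast]
      have := hzG m
      push_cast
      field_simp
      linear_combination -this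
    have hQf : Q.map (algebraMap ℚ ℂ) = qExpansion 1 (⇑f) := by
      ext m
      rw [PowerSeries.coeff_map, hQ, PowerSeries.coeff_mk, qExpansion_eq_mk_cuspCoeff, PowerSeries.coeff_mk,
        hW₁.2 m, eq_ratCast]
      push_cast
      rfl
    refine ⟨PowerSeries.coeff n (P * Q ^ a), ?_⟩
    rw [hq, ← hPG, ← hQf, ← map_pow, ← map_mul, PowerSeries.coeff_map, eq_ratCast]
  · -- `Φ₁ = x_{W₁}·G₁` off the poles
    intro τ hτ
    have hτ'' : eichlerIntegral f τ ∉ L''.lattice := fun h ↦ hτ ((hmem'' _).mp h)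
    rw [CuspForm.sub_apply, CuspForm.IsGLPos.smul_apply, CuspForm.IsGLPos.smul_apply, smul_eq_mul, smul_eq_mul,
      hΦ τ hτ'', hscale]
    ring

end Summit.BirchSwinnertonDyer.BirchSwinnertonDyer.Theorems.DepletionAtTwo.X1Denominator

end
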